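import Summits.Ventures.PercRepro.SevenThreeWitnessStructure

/-!
# PercRepro — the `(7,3)` cell, (R6) part (b), continued: the global witness-structure counts (night-3, gen 4)

Continuation of `SevenThreeWitnessStructure.lean`.  For a plane `G` and `K ⊆ E ∖ G` with `ρ(G ∪ K) = 7`, against a
spanning `4`-subset `B₀ ⊆ K`:
* `|K| = 6` (`witness_structure_six`): at most `3` pairs of rank `4` over `G` (`{y, z}` and at most one `{y, b}`,
  one `{z, b}`), at most `1` triple of rank `4` (`{y, z, b}` with `b ∥ y`), and at most `10` triples of rank `≤ 5`
  (the `4` triples of `B₀` and `≥ 3` of the `6` triples `{y} ∪ p`, `{z} ∪ p` have rank `6`);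
* `|K| = 5` (`witness_structure_five`): at most `1` / exactly `0` / at most `3`;
* `|K| = 4` (`eRk_union_eq_of_free`): every `X ⊆ K` has `ρ(G ∪ X) = 3 + |X|`.
These are mine-2 §26.1's `(π, τ₁, τ₁ + τ₂) ≤ (3, 1, 10)`, `(1, 0, 3)`, `(0, 0, 0)`.  Axioms: standard.
-/

namespace PercRepro

namespace SevenThree

open Finset ThmH

variable {α : Type*} [DecidableEq α] {M : Matroid α} [M.Finite]

/-- `insert y` is injective on the pairs of `B₀` when `y ∉ B₀`. -/
theorem insert_injOn_powersetCard {B₀ : Finset α} {y : α} (hyB : y ∉ B₀) (F : Finset (Finset α))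
    (hF : F ⊆ B₀.powersetCard 2) : Set.InjOn (fun p => insert y p) (F : Set (Finset α)) := by
  intro p hp p' hp' h
  have hyp : y ∉ p := fun hy => hyB ((Finset.mem_powersetCard.1 (hF hp)).1 hy)
  have hyp' : y ∉ p' := fun hy => hyB ((Finset.mem_powersetCard.1 (hF hp')).1 hy)
  simp only at h
  have h' := congrArg (fun t : Finset α => t.erase y) h
  simp only [Finset.erase_insert hyp, Finset.erase_insert hyp'] at h'
  exact h'

omit [M.Finite] in
/-- The rank-`6` triples through `y ∉ B₀`: `{y} ∪ p` for the good pairs `p ⊆ B₀`. -/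
theorem image_insert_subset_six {G K B₀ : Finset α} (hB₀K : B₀ ⊆ K)
    {y : α} (hyK : y ∈ K) (hyB : y ∉ B₀) :
    ((B₀.powersetCard 2).filter (fun p => M.eRk ((G ∪ insert y p : Finset α) : Set α) = 6)).image
        (fun p => insert y p) ⊆
      (K.powersetCard 3).filter (fun X => M.eRk ((G ∪ X : Finset α) : Set α) = 6) := by
  intro T hT
  rw [Finset.mem_image] at hT
  obtain ⟨p, hp, rfl⟩ := hT
  rw [Finset.mem_filter, Finset.mem_powersetCard] at hp ⊢
  refine ⟨⟨Finset.insert_subset hyK (hp.1.1.trans hB₀K), ?_⟩, hp.2⟩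
  rw [Finset.card_insert_of_notMem (fun h => hyB (hp.1.1 h)), hp.1.2]

/-- **The witness structure at `|K| = 6`** (`t = 1`): `π ≤ 3`, `τ₁ ≤ 1`, `τ₁ + τ₂ ≤ 10`. -/
theorem witness_structure_six {G K : Finset α} (hG : G ∈ planes M) (hK : K ⊆ gr M) (hKG : Disjoint K G)
    (hr : M.eRk ((G ∪ K : Finset α) : Set α) = 7) (hK6 : K.card = 6) :
    ((K.powersetCard 2).filter (fun X => M.eRk ((G ∪ X : Finset α) : Set α) = 4)).card ≤ 3 ∧
    ((K.powersetCard 3).filter (fun X => M.eRk ((G ∪ X : Finset α) : Set α) = 4)).card ≤ 1 ∧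
    ((K.powersetCard 3).filter (fun X => M.eRk ((G ∪ X : Finset α) : Set α) ≤ 5)).card ≤ 10 := by
  classical
  have hG3 := (mem_planes.1 hG).2.2
  obtain ⟨B₀, hB₀K, hB₀4, hB₀r⟩ := exists_four_spanning hG hK hr
  have hKB : (K \ B₀).card = 2 := by
    rw [Finset.card_sdiff, Finset.inter_eq_left.2 hB₀K, hK6, hB₀4]
  obtain ⟨y, z, hyz, hKB'⟩ := Finset.card_eq_two.1 hKB
  have hyKB : y ∈ K \ B₀ := by rw [hKB']; exact Finset.mem_insert_self y {z}
  have hzKB : z ∈ K \ B₀ := by rw [hKB']; exact Finset.mem_insert_of_mem (Finset.mem_singleton_self z)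
  have hyK : y ∈ K := (Finset.mem_sdiff.1 hyKB).1
  have hyB : y ∉ B₀ := (Finset.mem_sdiff.1 hyKB).2
  have hzK : z ∈ K := (Finset.mem_sdiff.1 hzKB).1
  have hzB : z ∉ B₀ := (Finset.mem_sdiff.1 hzKB).2
  have hy : y ∈ gr M := hK hyK
  have hyG : y ∉ G := Finset.disjoint_left.1 hKG hyK
  have hz : z ∈ gr M := hK hzK
  have hzG : z ∉ G := Finset.disjoint_left.1 hKG hzK
  have hmemK : ∀ u ∈ K, u ∈ B₀ ∨ u = y ∨ u = z := by
    intro u hu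
    by_cases huB : u ∈ B₀
    · exact Or.inl huB
    · have : u ∈ K \ B₀ := Finset.mem_sdiff.2 ⟨hu, huB⟩
      rw [hKB', Finset.mem_insert, Finset.mem_singleton] at this
      exact Or.inr this
  -- two points of `B₀` never give rank `4`
  have hfive : ∀ u ∈ B₀, ∀ v ∈ B₀, u ≠ v → M.eRk ((G ∪ {u, v} : Finset α) : Set α) = 5 :=
    fun u hu v hv huv => eRk_pair_eq_five_of_free hG3 hB₀4 hB₀r hu hv huv
  refine ⟨?_, ?_, ?_⟩
  · -- the pairs of rank `4`
    have hsub : (K.powersetCard 2).filter (fun X => M.eRk ((G ∪ X : Finset α) : Set α) = 4) ⊆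
        {({y, z} : Finset α)} ∪
          (B₀.filter (fun b => M.eRk ((G ∪ {y, b} : Finset α) : Set α) = 4)).image (fun b => ({y, b} : Finset α)) ∪
          (B₀.filter (fun b => M.eRk ((G ∪ {z, b} : Finset α) : Set α) = 4)).image (fun b => ({z, b} : Finset α)) := by
      intro X hX
      rw [Finset.mem_filter, Finset.mem_powersetCard] at hX
      obtain ⟨⟨hXK, hX2⟩, hX4⟩ := hX
      obtain ⟨u, v, huv, rfl⟩ := Finset.card_eq_two.1 hX2
      have hu : u ∈ K := hXK (Finset.mem_insert_self u {v})
      have hv : v ∈ K := hXK (Finset.mem_insert_of_mem (Finset.mem_singleton_self v))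
      rw [Finset.mem_union, Finset.mem_union, Finset.mem_singleton, Finset.mem_image, Finset.mem_image]
      rcases hmemK u hu with huB | rfl | rfl <;> rcases hmemK v hv with hvB | rfl | rfl
      · exfalso
        have := hfive u huB v hvB huv
        rw [hX4] at this
        exact absurd this (by decide)
      · left; right
        exact ⟨u, Finset.mem_filter.2 ⟨huB, by rw [Finset.pair_comm]; exact hX4⟩, Finset.pair_comm _ _⟩
      · right
        exact ⟨u, Finset.mem_filter.2 ⟨huB, by rw [Finset.pair_comm]; exact hX4⟩, Finset.pair_comm _ _⟩
      · left; right
        exact ⟨v, Finset.mem_filter.2 ⟨hvB, hX4⟩, rfl⟩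
      · exact absurd rfl huv
      · left; left; rfl
      · right
        exact ⟨v, Finset.mem_filter.2 ⟨hvB, hX4⟩, rfl⟩
      · left; left
        exact Finset.pair_comm _ _
      · exact absurd rfl huv
    calc _ ≤ ({({y, z} : Finset α)} ∪
          (B₀.filter (fun b => M.eRk ((G ∪ {y, b} : Finset α) : Set α) = 4)).image (fun b => ({y, b} : Finset α)) ∪
          (B₀.filter (fun b => M.eRk ((G ∪ {z, b} : Finset α) : Set α) = 4)).image (fun b => ({z, b} : Finset α))).card :=
          Finset.card_le_card hsub
      _ ≤ 1 + 1 + 1 := by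
          refine (Finset.card_union_le _ _).trans (add_le_add ((Finset.card_union_le _ _).trans (add_le_add ?_ ?_)) ?_)
          · rw [Finset.card_singleton]
          · exact Finset.card_image_le.trans (card_parallel_le_one hG hB₀4 hB₀r hy hyG)
          · exact Finset.card_image_le.trans (card_parallel_le_one hG hB₀4 hB₀r hz hzG)
  · -- the triples of rank `4`: `{y, z, b}` with `b ∥ y`
    have hsub : (K.powersetCard 3).filter (fun X => M.eRk ((G ∪ X : Finset α) : Set α) = 4) ⊆
        (B₀.filter (fun b => M.eRk ((G ∪ {y, b} : Finset α) : Set α) = 4)).image (fun b => insert b {y, z}) := by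
      intro X hX
      rw [Finset.mem_filter, Finset.mem_powersetCard] at hX
      obtain ⟨⟨hXK, hX3⟩, hX4⟩ := hX
      have hXB : (X ∩ B₀).card ≤ 1 := by
        rw [Finset.card_le_one]
        intro b hb b' hb'
        by_contra hne
        have h5 := hfive b (Finset.mem_inter.1 hb).2 b' (Finset.mem_inter.1 hb').2 hne
        have hmono : M.eRk ((G ∪ {b, b'} : Finset α) : Set α) ≤ M.eRk ((G ∪ X : Finset α) : Set α) := by
          apply M.eRk_mono
          rw [Finset.coe_subset]
          apply Finset.union_subset_union (Finset.Subset.refl G)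
          intro w hw
          rw [Finset.mem_insert, Finset.mem_singleton] at hw
          rcases hw with rfl | rfl
          · exact (Finset.mem_inter.1 hb).1
          · exact (Finset.mem_inter.1 hb').1
        rw [h5, hX4] at hmono
        exact absurd hmono (by decide)
      have hXdiff : X \ B₀ ⊆ {y, z} := by
        intro u hu
        rw [Finset.mem_sdiff] at hu
        rw [← hKB']
        exact Finset.mem_sdiff.2 ⟨hXK hu.1, hu.2⟩
      have hcard := Finset.card_sdiff_add_card_inter X B₀
      have h2 : 2 ≤ (X \ B₀).card := by
        have h := hcard
        rw [hX3] at h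
        omega
      have hXdiff' : X \ B₀ = {y, z} :=
        Finset.eq_of_subset_of_card_le hXdiff (by rw [Finset.card_pair hyz]; exact h2)
      have hXB1 : (X ∩ B₀).card = 1 := by
        have h := hcard
        rw [hXdiff', Finset.card_pair hyz, hX3] at h
        omega
      obtain ⟨b, hb⟩ := Finset.card_eq_one.1 hXB1
      have hbXB : b ∈ X ∩ B₀ := by rw [hb]; exact Finset.mem_singleton_self b
      have hbX : b ∈ X := (Finset.mem_inter.1 hbXB).1
      have hbB : b ∈ B₀ := (Finset.mem_inter.1 hbXB).2
      have hyX : y ∈ X := (Finset.mem_sdiff.1 (hXdiff' ▸ Finset.mem_insert_self y {z})).1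
      rw [Finset.mem_image]
      refine ⟨b, ?_, ?_⟩
      · rw [Finset.mem_filter]
        refine ⟨hbB, le_antisymm ?_ ?_⟩
        · rw [← hX4]
          apply M.eRk_mono
          rw [Finset.coe_subset]
          apply Finset.union_subset_union (Finset.Subset.refl G)
          intro w hw
          rw [Finset.mem_insert, Finset.mem_singleton] at hw
          rcases hw with rfl | rfl
          · exact hyX
          · exact hbX
        · rw [← eRk_union_singleton_eq_four hG hy hyG]
          apply M.eRk_mono
          rw [Finset.coe_subset]
          exact Finset.union_subset_union (Finset.Subset.refl G)
            (Finset.singleton_subset_iff.2 (Finset.mem_insert_self y {b}))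
      · rw [← Finset.sdiff_union_inter X B₀, hXdiff', hb, Finset.union_comm, Finset.singleton_union]
    exact (Finset.card_le_card hsub).trans
      (Finset.card_image_le.trans (card_parallel_le_one hG hB₀4 hB₀r hy hyG))
  · -- the triples of rank `≤ 5`: at least `10` of the `20` triples have rank `6`
    set T₆ := (K.powersetCard 3).filter (fun X => M.eRk ((G ∪ X : Finset α) : Set α) = 6) with hT₆
    set Qy := (B₀.powersetCard 2).filter (fun p => M.eRk ((G ∪ insert y p : Finset α) : Set α) = 6) with hQy
    set Qz := (B₀.powersetCard 2).filter (fun p => M.eRk ((G ∪ insert z p : Finset α) : Set α) = 6) with hQz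
    have hA : B₀.powersetCard 3 ⊆ T₆ := by
      intro T hT
      rw [Finset.mem_powersetCard] at hT
      rw [hT₆, Finset.mem_filter, Finset.mem_powersetCard]
      exact ⟨⟨hT.1.trans hB₀K, hT.2⟩, eRk_triple_eq_six_of_free hG3 hB₀4 hB₀r hT.1 hT.2⟩
    have hIy : Qy.image (fun p => insert y p) ⊆ T₆ := image_insert_subset_six hB₀K hyK hyB
    have hIz : Qz.image (fun p => insert z p) ⊆ T₆ := image_insert_subset_six hB₀K hzK hzB
    have hdisj1 : Disjoint (B₀.powersetCard 3 ∪ Qy.image (fun p => insert y p)) (Qz.image (fun p => insert z p)) := by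
      rw [Finset.disjoint_left]
      intro T hT hT'
      rw [Finset.mem_image] at hT'
      obtain ⟨p, hp, rfl⟩ := hT'
      rw [Finset.mem_union, Finset.mem_powersetCard, Finset.mem_image] at hT
      rcases hT with ⟨hTB, -⟩ | ⟨p', hp', h⟩
      · exact hzB (hTB (Finset.mem_insert_self z p))
      · have hzp' : z ∈ insert y p' := by rw [h]; exact Finset.mem_insert_self z p
        rw [Finset.mem_insert] at hzp'
        rcases hzp' with h | h
        · exact hyz h.symm
        · exact hzB ((Finset.mem_powersetCard.1 (Finset.mem_filter.1 hp').1).1 h)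
    have hdisj2 : Disjoint (B₀.powersetCard 3) (Qy.image (fun p => insert y p)) := by
      rw [Finset.disjoint_left]
      intro T hT hT'
      rw [Finset.mem_image] at hT'
      obtain ⟨p, hp, rfl⟩ := hT'
      rw [Finset.mem_powersetCard] at hT
      exact hyB (hT.1 (Finset.mem_insert_self y p))
    have hcardA : (B₀.powersetCard 3).card = 4 := by rw [Finset.card_powersetCard, hB₀4]; decide
    have hcardIy : (Qy.image (fun p => insert y p)).card = Qy.card :=
      Finset.card_image_of_injOn (insert_injOn_powersetCard hyB Qy (Finset.filter_subset _ _))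
    have hcardIz : (Qz.image (fun p => insert z p)).card = Qz.card :=
      Finset.card_image_of_injOn (insert_injOn_powersetCard hzB Qz (Finset.filter_subset _ _))
    have hQy3 : 3 ≤ Qy.card := three_le_card_pairs_six hG hB₀4 hB₀r hy hyG hyB
    have hQz3 : 3 ≤ Qz.card := three_le_card_pairs_six hG hB₀4 hB₀r hz hzG hzB
    have hT₆10 : 10 ≤ T₆.card := by
      calc 10 ≤ (B₀.powersetCard 3).card + Qy.card + Qz.card := by omega
        _ = ((B₀.powersetCard 3 ∪ Qy.image (fun p => insert y p)) ∪ Qz.image (fun p => insert z p)).card := by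
            rw [Finset.card_union_of_disjoint hdisj1, Finset.card_union_of_disjoint hdisj2, hcardIy, hcardIz]
        _ ≤ T₆.card := Finset.card_le_card (Finset.union_subset (Finset.union_subset hA hIy) hIz)
    have hsplit := Finset.card_filter_add_card_filter_not (s := K.powersetCard 3)
      (p := fun X => M.eRk ((G ∪ X : Finset α) : Set α) = 6)
    rw [← hT₆] at hsplit
    have h20 : (K.powersetCard 3).card = 20 := by rw [Finset.card_powersetCard, hK6]; decide
    have hsub : (K.powersetCard 3).filter (fun X => M.eRk ((G ∪ X : Finset α) : Set α) ≤ 5) ⊆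
        (K.powersetCard 3).filter (fun X => ¬ M.eRk ((G ∪ X : Finset α) : Set α) = 6) := by
      intro X hX
      rw [Finset.mem_filter] at hX ⊢
      refine ⟨hX.1, fun h => ?_⟩
      rw [h] at hX
      exact absurd hX.2 (by decide)
    have := Finset.card_le_card hsub
    omega

/-- **The witness structure at `|K| = 5`** (`t = 2`): `π ≤ 1`, `τ₁ = 0`, `τ₁ + τ₂ ≤ 3`. -/
theorem witness_structure_five {G K : Finset α} (hG : G ∈ planes M) (hK : K ⊆ gr M) (hKG : Disjoint K G)
    (hr : M.eRk ((G ∪ K : Finset α) : Set α) = 7) (hK5 : K.card = 5) :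
    ((K.powersetCard 2).filter (fun X => M.eRk ((G ∪ X : Finset α) : Set α) = 4)).card ≤ 1 ∧
    ((K.powersetCard 3).filter (fun X => M.eRk ((G ∪ X : Finset α) : Set α) = 4)).card = 0 ∧
    ((K.powersetCard 3).filter (fun X => M.eRk ((G ∪ X : Finset α) : Set α) ≤ 5)).card ≤ 3 := by
  classical
  have hG3 := (mem_planes.1 hG).2.2
  obtain ⟨B₀, hB₀K, hB₀4, hB₀r⟩ := exists_four_spanning hG hK hr
  have hKB : (K \ B₀).card = 1 := by
    rw [Finset.card_sdiff, Finset.inter_eq_left.2 hB₀K, hK5, hB₀4]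
  obtain ⟨y, hKB'⟩ := Finset.card_eq_one.1 hKB
  have hyKB : y ∈ K \ B₀ := by rw [hKB']; exact Finset.mem_singleton_self y
  have hyK : y ∈ K := (Finset.mem_sdiff.1 hyKB).1
  have hyB : y ∉ B₀ := (Finset.mem_sdiff.1 hyKB).2
  have hy : y ∈ gr M := hK hyK
  have hyG : y ∉ G := Finset.disjoint_left.1 hKG hyK
  have hmemK : ∀ u ∈ K, u ∈ B₀ ∨ u = y := by
    intro u hu
    by_cases huB : u ∈ B₀
    · exact Or.inl huB
    · have : u ∈ K \ B₀ := Finset.mem_sdiff.2 ⟨hu, huB⟩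
      rw [hKB', Finset.mem_singleton] at this
      exact Or.inr this
  have hfive : ∀ u ∈ B₀, ∀ v ∈ B₀, u ≠ v → M.eRk ((G ∪ {u, v} : Finset α) : Set α) = 5 :=
    fun u hu v hv huv => eRk_pair_eq_five_of_free hG3 hB₀4 hB₀r hu hv huv
  refine ⟨?_, ?_, ?_⟩
  · have hsub : (K.powersetCard 2).filter (fun X => M.eRk ((G ∪ X : Finset α) : Set α) = 4) ⊆
        (B₀.filter (fun b => M.eRk ((G ∪ {y, b} : Finset α) : Set α) = 4)).image (fun b => ({y, b} : Finset α)) := by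
      intro X hX
      rw [Finset.mem_filter, Finset.mem_powersetCard] at hX
      obtain ⟨⟨hXK, hX2⟩, hX4⟩ := hX
      obtain ⟨u, v, huv, rfl⟩ := Finset.card_eq_two.1 hX2
      have hu : u ∈ K := hXK (Finset.mem_insert_self u {v})
      have hv : v ∈ K := hXK (Finset.mem_insert_of_mem (Finset.mem_singleton_self v))
      rw [Finset.mem_image]
      rcases hmemK u hu with huB | rfl <;> rcases hmemK v hv with hvB | rfl
      · exfalso
        have := hfive u huB v hvB huv
        rw [hX4] at this
        exact absurd this (by decide)
      · exact ⟨u, Finset.mem_filter.2 ⟨huB, by rw [Finset.pair_comm]; exact hX4⟩, Finset.pair_comm _ _⟩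
      · exact ⟨v, Finset.mem_filter.2 ⟨hvB, hX4⟩, rfl⟩
      · exact absurd rfl huv
    exact (Finset.card_le_card hsub).trans
      (Finset.card_image_le.trans (card_parallel_le_one hG hB₀4 hB₀r hy hyG))
  · rw [Finset.card_eq_zero, Finset.filter_eq_empty_iff]
    intro X hX hX4
    rw [Finset.mem_powersetCard] at hX
    -- `X` has at least two points of `B₀`
    have hXdiff : (X \ B₀).card ≤ 1 := by
      rw [← hKB]
      exact Finset.card_le_card (fun u hu => by
        rw [Finset.mem_sdiff] at hu ⊢
        exact ⟨hX.1 hu.1, hu.2⟩)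
    have hcard := Finset.card_sdiff_add_card_inter X B₀
    have hXB : 2 ≤ (X ∩ B₀).card := by omega
    obtain ⟨b, hb, b', hb', hbb'⟩ := Finset.one_lt_card.1 hXB
    have h5 := hfive b (Finset.mem_inter.1 hb).2 b' (Finset.mem_inter.1 hb').2 hbb'
    have hmono : M.eRk ((G ∪ {b, b'} : Finset α) : Set α) ≤ M.eRk ((G ∪ X : Finset α) : Set α) := by
      apply M.eRk_mono
      rw [Finset.coe_subset]
      apply Finset.union_subset_union (Finset.Subset.refl G)
      intro w hw
      rw [Finset.mem_insert, Finset.mem_singleton] at hw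
      rcases hw with rfl | rfl
      · exact (Finset.mem_inter.1 hb).1
      · exact (Finset.mem_inter.1 hb').1
    rw [h5, hX4] at hmono
    exact absurd hmono (by decide)
  · set T₆ := (K.powersetCard 3).filter (fun X => M.eRk ((G ∪ X : Finset α) : Set α) = 6) with hT₆
    set Qy := (B₀.powersetCard 2).filter (fun p => M.eRk ((G ∪ insert y p : Finset α) : Set α) = 6) with hQy
    have hA : B₀.powersetCard 3 ⊆ T₆ := by
      intro T hT
      rw [Finset.mem_powersetCard] at hT
      rw [hT₆, Finset.mem_filter, Finset.mem_powersetCard]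
      exact ⟨⟨hT.1.trans hB₀K, hT.2⟩, eRk_triple_eq_six_of_free hG3 hB₀4 hB₀r hT.1 hT.2⟩
    have hIy : Qy.image (fun p => insert y p) ⊆ T₆ := image_insert_subset_six hB₀K hyK hyB
    have hdisj2 : Disjoint (B₀.powersetCard 3) (Qy.image (fun p => insert y p)) := by
      rw [Finset.disjoint_left]
      intro T hT hT'
      rw [Finset.mem_image] at hT'
      obtain ⟨p, hp, rfl⟩ := hT'
      rw [Finset.mem_powersetCard] at hT
      exact hyB (hT.1 (Finset.mem_insert_self y p))
    have hcardA : (B₀.powersetCard 3).card = 4 := by rw [Finset.card_powersetCard, hB₀4]; decide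
    have hcardIy : (Qy.image (fun p => insert y p)).card = Qy.card :=
      Finset.card_image_of_injOn (insert_injOn_powersetCard hyB Qy (Finset.filter_subset _ _))
    have hQy3 : 3 ≤ Qy.card := three_le_card_pairs_six hG hB₀4 hB₀r hy hyG hyB
    have hT₆7 : 7 ≤ T₆.card := by
      calc 7 ≤ (B₀.powersetCard 3).card + Qy.card := by omega
        _ = (B₀.powersetCard 3 ∪ Qy.image (fun p => insert y p)).card := by
            rw [Finset.card_union_of_disjoint hdisj2, hcardIy]
        _ ≤ T₆.card := Finset.card_le_card (Finset.union_subset hA hIy)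
    have hsplit := Finset.card_filter_add_card_filter_not (s := K.powersetCard 3)
      (p := fun X => M.eRk ((G ∪ X : Finset α) : Set α) = 6)
    rw [← hT₆] at hsplit
    have h10 : (K.powersetCard 3).card = 10 := by rw [Finset.card_powersetCard, hK5]; decide
    have hsub : (K.powersetCard 3).filter (fun X => M.eRk ((G ∪ X : Finset α) : Set α) ≤ 5) ⊆
        (K.powersetCard 3).filter (fun X => ¬ M.eRk ((G ∪ X : Finset α) : Set α) = 6) := by
      intro X hX
      rw [Finset.mem_filter] at hX ⊢
      refine ⟨hX.1, fun h => ?_⟩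
      rw [h] at hX
      exact absurd hX.2 (by decide)
    have := Finset.card_le_card hsub
    omega

end SevenThree

end PercRepro
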